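import Literature.AlgebraicTopology.FundamentalGroup.IsotopyTrack
import Mathlib.AlgebraicTopology.FundamentalGroupoid.SimplyConnected
import HarnessLib

/-!
# The effect of a handle flip on the loop through the handle

Topic `Literature/AlgebraicTopology/FundamentalGroup` (supporting the fact seat
`provefact-Literature.Topology.FourManifolds.lauden-f709dd520c`, Laudenbach–Poénaru's Lemma 2:
the flip `H₂`, "`Φ₂(x₁) = x₁⁻¹`", p. 339).  Pure algebraic topology; everything **proved**,
no named facts.

Let `G : Y → Y` be a continuous self-map fixing the base point `y₀`, and consider the loop
through a handle written as in `SlideBasisLoop.mk_arcLoop_eq`: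
`x = [A₋ · O₁⁻¹ · P₂ · O₃ · A₊⁻¹]`, where `A₋ : y₀ ⟶ w₋`, `A₊ : y₀ ⟶ w₊` run below the handle,
`O₁ : F₋ ⟶ w₋`, `O₃ : F₊ ⟶ w₊` are the flow lines of the two feet `F∓` and `P₂ : F₋ ⟶ F₊` is
the core arc.  Suppose `G` **exchanges the feet** (`G F₋ = F₊`, `G F₊ = F₋`) and **reverses the
core arc up to homotopy** (`G ∘ P₂ ≃ P₂⁻¹` rel end points).  Then (`mapOfEq_mk_arcLoop_of_reverses`)

`G_# x = u · x⁻¹ · v`, `u = [G∘A₋ · (G∘O₁)⁻¹ · O₃ · A₊⁻¹]`, `v = [A₋ · O₁⁻¹ · G∘O₃ · (G∘A₊)⁻¹]`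

— an identity in the fundamental groupoid (no isotopy is needed, in contrast with
`IsotopyTrack.mapOfEq_mk_arcLoop_of_flip`).  In the application `u` and `v` are loops below
the handle, so that `G_#` is Laudenbach–Poénaru's `Φ₂` up to the subgroup generated by the other
handles.  The images `G ∘ A±`, `G ∘ O₁`, `G ∘ O₃`, `G ∘ P₂` enter as arbitrary paths agreeing with
them pointwise (their end points agree with the expected ones only propositionally).

All statements are equalities in `Path.Homotopic.Quotient` (concatenation read from left to
right), wrapped in `FundamentalGroup.fromPath`.

## References

* F. Laudenbach, V. Poénaru, *A note on 4-dimensional handlebodies*, Bull. Soc. Math. France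
  100 (1972), §2, proof of Lemma 2 (pp. 339–340). [LaudenbachPoenaruBSMF1972]
* A. Hatcher, *Algebraic Topology* (2002), §1.1 (path groupoid algebra). [HatcherAT2002]
-/

noncomputable section

open scoped unitInterval
open Set Function

namespace Literature.AlgebraicTopology.FundamentalGroup

namespace FlipTrack

variable {Y : Type*} [TopologicalSpace Y]

/-- Groupoid bookkeeping for the flip: with `R = P₂⁻¹` (as classes),
`B₋ · Q₁⁻¹ · R · Q₃ · B₊⁻¹ = (B₋ · Q₁⁻¹ · O₃ · A₊⁻¹) · (A₋ · O₁⁻¹ · P₂ · O₃ · A₊⁻¹)⁻¹ · (A₋ · O₁⁻¹ · Q₃ · B₊⁻¹)`.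
[folklore] -/
theorem quotient_flip_identity {y₀ wm wp Fm Fp bm bp : Y} (Am : Path y₀ wm) (Ap : Path y₀ wp)
    (O₁ : Path Fm wm) (P₂ : Path Fm Fp) (O₃ : Path Fp wp) (Bm : Path y₀ bm) (Bp : Path y₀ bp)
    (Q₁ : Path Fp bm) (Q₃ : Path Fm bp) (R : Path Fp Fm)
    (hR : Path.Homotopic.Quotient.mk R = (Path.Homotopic.Quotient.mk P₂).symm) :
    Path.Homotopic.Quotient.mk ((Bm.trans ((Q₁.symm.trans R).trans Q₃)).trans Bp.symm) =
      ((Path.Homotopic.Quotient.mk ((Bm.trans Q₁.symm).trans (O₃.trans Ap.symm))).trans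
        (Path.Homotopic.Quotient.mk ((Am.trans ((O₁.symm.trans P₂).trans O₃)).trans Ap.symm)).symm).trans
        (Path.Homotopic.Quotient.mk ((Am.trans O₁.symm).trans (Q₃.trans Bp.symm))) := by
  simp only [Path.Homotopic.Quotient.mk_trans, Path.Homotopic.Quotient.mk_symm, hR,
    Path.Homotopic.Quotient.trans_assoc, IsotopyTrack.quotient_symm_trans, IsotopyTrack.quotient_symm_symm,
    IsotopyTrack.quotient_symm_trans_trans, IsotopyTrack.quotient_trans_symm_trans]

/-- **Handle flip, without isotopy.**  Let `G` fix `y₀`, exchange the feet `F₋`, `F₊` (this is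
forced by the types of `Q₁`, `Q₃`, `R`), and reverse the core arc up to homotopy: `R ≃ P₂⁻¹`
where `R` is `G ∘ P₂` pointwise.  Let `B∓`, `Q₁`, `Q₃` be
`G ∘ A∓`, `G ∘ O₁`, `G ∘ O₃` pointwise.  Then
`G_# [A₋ · O₁⁻¹ · P₂ · O₃ · A₊⁻¹] = [B₋ · Q₁⁻¹ · O₃ · A₊⁻¹] · [A₋ · O₁⁻¹ · P₂ · O₃ · A₊⁻¹]⁻¹ · [A₋ · O₁⁻¹ · Q₃ · B₊⁻¹]`.
[cite: LaudenbachPoenaruBSMF1972, §2, proof of Lemma 2 (pp. 339–340)] [cite: HatcherAT2002, §1.1] -/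
theorem mapOfEq_mk_arcLoop_of_reverses (G : C(Y, Y)) {y₀ wm wp Fm Fp : Y} (hG : G y₀ = y₀)
    (Am : Path y₀ wm) (Ap : Path y₀ wp) (O₁ : Path Fm wm) (P₂ : Path Fm Fp) (O₃ : Path Fp wp)
    (Bm : Path y₀ (G wm)) (hBm : ∀ s, Bm s = G (Am s)) (Bp : Path y₀ (G wp)) (hBp : ∀ s, Bp s = G (Ap s))
    (Q₁ : Path Fp (G wm)) (hQ₁ : ∀ s, Q₁ s = G (O₁ s)) (Q₃ : Path Fm (G wp)) (hQ₃ : ∀ s, Q₃ s = G (O₃ s))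
    (R : Path Fp Fm) (hRG : ∀ s, R s = G (P₂ s)) (hR : R.Homotopic P₂.symm) :
    FundamentalGroup.mapOfEq G hG
        (FundamentalGroup.fromPath (Path.Homotopic.Quotient.mk ((Am.trans ((O₁.symm.trans P₂).trans O₃)).trans Ap.symm))) =
      FundamentalGroup.fromPath
        (((Path.Homotopic.Quotient.mk ((Bm.trans Q₁.symm).trans (O₃.trans Ap.symm))).trans
          (Path.Homotopic.Quotient.mk ((Am.trans ((O₁.symm.trans P₂).trans O₃)).trans Ap.symm)).symm).trans
          (Path.Homotopic.Quotient.mk ((Am.trans O₁.symm).trans (Q₃.trans Bp.symm)))) := by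
  set L := (Am.trans ((O₁.symm.trans P₂).trans O₃)).trans Ap.symm with hL
  rw [FundamentalGroup.mapOfEq_apply]
  change (Path.Homotopic.Quotient.map (Path.Homotopic.Quotient.mk L) G).cast hG.symm hG.symm = _
  rw [← Path.Homotopic.Quotient.mk_map, ← Path.Homotopic.Quotient.mk_cast]
  -- the image loop, pointwise
  have e : (L.map (map_continuous G)).cast hG.symm hG.symm = (Bm.trans ((Q₁.symm.trans R).trans Q₃)).trans Bp.symm := by
    ext t
    show G (L t) = ((Bm.trans ((Q₁.symm.trans R).trans Q₃)).trans Bp.symm) t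
    simp only [hL, Path.trans_apply, Path.symm_apply]
    split_ifs <;> simp only [Function.comp_apply, hBm, hBp, hQ₁, hQ₃, hRG]
  rw [e]
  have hR' : Path.Homotopic.Quotient.mk R = (Path.Homotopic.Quotient.mk P₂).symm := by
    rw [← Path.Homotopic.Quotient.mk_symm]; exact Quotient.sound hR
  exact congrArg FundamentalGroup.fromPath (quotient_flip_identity Am Ap O₁ P₂ O₃ Bm Bp Q₁ Q₃ R hR')

/-- **Paths in an arc are homotopic.**  If two paths with the same end points run inside the
image of a topological embedding of a real interval (more generally: inside a subspace which is
simply connected), they are homotopic rel end points. [cite: HatcherAT2002, §1.1 (Prop. 1.6 ff.)] -/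
theorem homotopic_of_range_subset_of_simplyConnected {A : Set Y} (hA : SimplyConnectedSpace A)
    {a b : Y} (p q : Path a b) (hp : range p ⊆ A) (hq : range q ⊆ A) : p.Homotopic q := by
  have ha : a ∈ A := by rw [← p.source]; exact hp (mem_range_self 0)
  have hb : b ∈ A := by rw [← p.target]; exact hp (mem_range_self 1)
  -- lift the two paths to `A`
  set p' : Path (⟨a, ha⟩ : A) ⟨b, hb⟩ :=
    { toFun := fun t => ⟨p t, hp (mem_range_self t)⟩
      continuous_toFun := p.continuous.subtype_mk _
      source' := Subtype.ext p.source
      target' := Subtype.ext p.target } with hp'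
  set q' : Path (⟨a, ha⟩ : A) ⟨b, hb⟩ :=
    { toFun := fun t => ⟨q t, hq (mem_range_self t)⟩
      continuous_toFun := q.continuous.subtype_mk _
      source' := Subtype.ext q.source
      target' := Subtype.ext q.target } with hq'
  have h : p'.Homotopic q' := SimplyConnectedSpace.paths_homotopic p' q'
  have ep : p = p'.map continuous_subtype_val := by ext t; rfl
  have eq : q = q'.map continuous_subtype_val := by ext t; rfl
  rw [ep, eq]
  exact h.map (ContinuousMap.mk Subtype.val continuous_subtype_val)

end FlipTrack

end Literature.AlgebraicTopology.FundamentalGroup
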